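import Summits.CriticalPhenomena.PercolationContinuityZ3.Theorems.Transplant.FKDoubleFanNegCorrAdjacent
import Summits.CriticalPhenomena.PercolationContinuityZ3.Theorems.Transplant.FKDoubleFanRimSpoke
import HarnessLib

/-!
# Double fans `K₂ ∨ P_{m+1}`: a rim edge is negatively correlated with the four spokes at its endpoints

Support file (`--supports stmt-CriticalPhenomena-4575`), FK sub-lane `prim-bschramm-fk-3` (gen 21); builds on p205010 (kernel theorem, internal
audit signed; external expert review pending).  No named facts, no sorries; standard axioms.  Memo `bschramm/prim-bschramm-fk-3/RIM-PAIRS.md`.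
Layer 6 of the double-fan bridge: the cut formula (`…DoubleFanNegCorr`) writes the partition functions with the rim edge `c_j c_{j+1}` and a
spoke of `c_{j+1}` (resp. of `c_j`) pinned as the `rimSpokeAZ` valuations of `…DoubleFanRimSpoke` with `u = Z_j`, `s = restVec_{j+1} ∗ edgeBC`
(resp., by the self-adjointness of the rim step, `u = restVec_{j+1} ∗ edgeAC ∗ edgeBC`, `s = edgeBC ∗ blockIn_j`), all in `InKE q`; the
certificate of that file then gives, for `0 < q ≤ 1`, every weight vector on the double fan and every `j + 1 ≤ m`:
**`negCorr_rim_spokeA_succ`** `φ(J_{c_j c_{j+1}} ∩ J_{a c_{j+1}}) ≤ φ(J_{c_j c_{j+1}}) φ(J_{a c_{j+1}})`, **`negCorr_rim_spokeA_self`** (the spoke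
`a c_j`), and the `b`-versions by the `a ↔ b` relabelling.  Together with layers 3–5: every pair of edges of a weighted double fan that share a
RIM vertex, except two consecutive rim edges, is now negatively correlated in the kernel, as are (axis, any spoke) and the same-apex spokes of
adjacent rim vertices.
[cite: Grimmett2006, §3.9 eq. (3.94) (pp. 63–64); §1.4 eq. (1.20) (p. 15)] [folklore]
-/

noncomputable section

namespace Summit.CriticalPhenomena.PercolationContinuityZ3.Theorems

namespace FK

namespace ThreeApex

open MeasureTheory Literature.Probability.LatticeModels Literature.Probability.Percolation
open scoped Classical

variable {V : Type*} [Fintype V]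

section Setting

variable {a b : V} {c : ℕ → V} {m : ℕ}
variable (hab : a ≠ b) (hinj : ∀ j k, j ≤ m → k ≤ m → c j = c k → j = k) (hca : ∀ j, j ≤ m → c j ≠ a) (hcb : ∀ j, j ≤ m → c j ≠ b)
include hab hinj hca hcb

omit [Fintype V] hab hinj hca hcb in
/-- The reversed suffix after block `j` unfolds by one block: `restVec_j^{(d+1)} = E_{r_j}(restVec_{j+1}^{(d)} ∗ edgeAC ∗ edgeBC)`. [folklore] -/
theorem restVec_succ (q : ℝ) (w : Sym2 V → unitInterval) (j d : ℕ) :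
    restVec q w a b c j (d + 1) = rimStep q (wR w s(c j, c (j + 1)))
      (conv (restVec q w a b c (j + 1) d) (conv (edgeAC (wR w s(a, c (j + 1)))) (edgeBC (wR w s(b, c (j + 1)))))) := rfl

/-! ### The rim edge `c_j c_{j+1}` and the spoke `a c_{j+1}` -/

omit [Fintype V] in
/-- **The word with the rim edge `c_j c_{j+1}` and the spoke `a c_{j+1}` pinned**, through the cut at block `j+1`:
`rimSpokeAZ q Z_j (restVec_{j+1} ∗ edgeBC(w_{b c_{j+1}})) β α`. [folklore] -/
theorem cut_pin_rim_spokeA_succ (q : ℝ) (w : Sym2 V → unitInterval) {j : ℕ} (hj : j + 1 ≤ m) (β α : unitInterval) :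
    transferDF q (Function.update (Function.update w s(c j, c (j + 1)) β) s(a, c (j + 1)) α) a b c m =
      rimSpokeAZ q (zDF q w a b c j) (conv (restVec q w a b c (j + 1) (m - (j + 1))) (edgeBC (wR w s(b, c (j + 1))))) (β : ℝ) (α : ℝ) := by
  set w₁ := Function.update w s(c j, c (j + 1)) β with hw₁
  set w₂ := Function.update w₁ s(a, c (j + 1)) α with hw₂
  have hlater1 : ∀ k, j + 1 < k → k ≤ m → ¬ ReadsAt a b c k s(c j, c (j + 1)) := fun k hk hkm hr =>
    absurd ((readsAt_rim_iff hinj hca hcb hj hkm).1 hr) (by omega)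
  have hlater2 : ∀ k, j + 1 < k → k ≤ m → ¬ ReadsAt a b c k s(a, c (j + 1)) := fun k hk hkm hr =>
    absurd ((readsAt_spokeA_iff hab hinj hca hcb hj hkm).1 hr) (by omega)
  have hrest : restVec q w₂ a b c (j + 1) (m - (j + 1)) = restVec q w a b c (j + 1) (m - (j + 1)) := by
    rw [hw₂, restVec_update_eq q w₁ α (m - (j + 1)) (j + 1) (by omega) hlater2, hw₁,
      restVec_update_eq q w β (m - (j + 1)) (j + 1) (by omega) hlater1]
  have hbefore : zDF q w₂ a b c j = zDF q w a b c j := by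
    rw [hw₂, zDF_update_eq_of_not_reads q w₁ α j (fun k hk hr => absurd ((readsAt_spokeA_iff hab hinj hca hcb hj (by omega)).1 hr) (by omega)),
      hw₁, zDF_update_eq_of_not_reads q w β j (fun k hk hr => absurd ((readsAt_rim_iff hinj hca hcb hj (by omega)).1 hr) (by omega))]
  have hα : wR w₂ s(a, c (j + 1)) = (α : ℝ) := by rw [hw₂, wR_update_self]
  have hβ : wR w₂ s(c j, c (j + 1)) = (β : ℝ) := by
    rw [hw₂, wR_update_of_ne w₁ (spokeA_ne_rim hca (j := j + 1) hj).symm, hw₁, wR_update_self]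
  have hy : wR w₂ s(b, c (j + 1)) = wR w s(b, c (j + 1)) := by
    rw [hw₂, wR_update_of_ne w₁ (spokeA_ne_spokeB hab hca hj).symm, hw₁, wR_update_of_ne w (spokeB_ne_rim hcb (j := j + 1) hj)]
  rw [transferDF_eq_cut q w₂ a b c hj, zDF_eq_block, hrest, blockIn_succ, hbefore, hα, hβ, hy]
  -- reassociate: s ∗ (AC α ∗ (BC y ∗ E u)) = (s ∗ BC y) ∗ (AC α ∗ E u)
  simp only [rimSpokeAZ, ← mul_def]
  rw [mul_left_comm (edgeAC (α : ℝ)) (edgeBC _), ← mul_assoc (restVec q w a b c (j + 1) (m - (j + 1)))]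

/-- **A RIM EDGE AND THE `a`-SPOKE AT ITS FAR ENDPOINT ARE NEGATIVELY CORRELATED** in every weighted double fan (`0 < q ≤ 1`, `card V = m + 3`,
`w` supported on the double fan, `j + 1 ≤ m`): `φ(J_{c_j c_{j+1}} ∩ J_{a c_{j+1}}) ≤ φ(J_{c_j c_{j+1}}) φ(J_{a c_{j+1}})`. [cite: Grimmett2006, §3.9 eq. (3.94) (pp. 63–64)] -/
theorem negCorr_rim_spokeA_succ (hcard : Fintype.card V = m + 3) {q : ℝ} (hq0 : 0 < q) (hq1 : q ≤ 1) (w : Sym2 V → unitInterval)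
    (hsupp : ∀ e, e ∉ dfPairs a b c m → w e = 0) {j : ℕ} (hj : j + 1 ≤ m) :
    (rcMeasureW w q ∅).real ({ω : BondConfig V | s(c j, c (j + 1)) ∈ ω} ∩ {ω | s(a, c (j + 1)) ∈ ω}) ≤
      (rcMeasureW w q ∅).real {ω : BondConfig V | s(c j, c (j + 1)) ∈ ω} *
        (rcMeasureW w q ∅).real {ω : BondConfig V | s(a, c (j + 1)) ∈ ω} := by
  have he : s(c j, c (j + 1)) ∈ dfPairs a b c m := (mem_dfPairs_iff a b c m _).2 (Or.inr (Or.inr ⟨j, hj, rfl⟩))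
  have hf : s(a, c (j + 1)) ∈ dfPairs a b c m := (mem_dfPairs_iff a b c m _).2 (Or.inr (Or.inl ⟨j + 1, hj, Or.inl rfl⟩))
  have hne : s(a, c (j + 1)) ≠ s(c j, c (j + 1)) := spokeA_ne_rim hca (j := j + 1) hj
  set u := zDF q w a b c j with hu
  set s := conv (restVec q w a b c (j + 1) (m - (j + 1))) (edgeBC (wR w s(b, c (j + 1)))) with hs
  have hZ : ∀ β α : unitInterval, rcPartitionFunctionW (Function.update (Function.update w s(c j, c (j + 1)) β) s(a, c (j + 1)) α) q ∅ =
      rimSpokeAZ q u s (β : ℝ) (α : ℝ) := by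
    intro β α
    rw [rcPartitionFunctionW_eq_transferDF hab hinj hca hcb hcard q _
      (supp_update_dfPair _ (supp_update_dfPair w hsupp he β) hf α),
      cut_pin_rim_spokeA_succ hab hinj hca hcb q w hj β α]
  have huK : InKE q u := inKE_zDF q w a b c j
  have hsK : InKE q s := InKE.mul (inKE_restVec q w a b c (m - (j + 1)) (j + 1)) (by
    rw [← mul_one (edgeBC (wR w s(b, c (j + 1)))), mul_def, one_def]
    exact InKE.step (IsLetter.bc (w _).2.1 (w _).2.2) InKE.base)
  have key := InKE.rayleigh_rim_spokeA_nonneg hq0.le hq1 huK hsK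
  refine negCorr_of_pinned_rayleigh w hq0 hne ?_
  rw [hZ 1 1, hZ 0 0, hZ 1 0, hZ 0 1]
  simp only [Set.Icc.coe_one, Set.Icc.coe_zero]
  linarith [key]

/-! ### The rim edge `c_j c_{j+1}` and the spoke `a c_j` -/

omit [Fintype V] in
/-- **The word with the rim edge `c_j c_{j+1}` and the spoke `a c_j` pinned**, through the cut at block `j` (the reversed suffix
unfolded once): `rimSpokeAZ q (restVec_{j+1} ∗ edgeAC(w_{a c_{j+1}}) ∗ edgeBC(w_{b c_{j+1}})) (edgeBC(w_{b c_j}) ∗ blockIn_j) β α`. [folklore] -/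
theorem cut_pin_rim_spokeA_self (q : ℝ) (w : Sym2 V → unitInterval) {j : ℕ} (hj : j + 1 ≤ m) (β α : unitInterval) :
    transferDF q (Function.update (Function.update w s(c j, c (j + 1)) β) s(a, c j) α) a b c m =
      rimSpokeAZ q (conv (restVec q w a b c (j + 1) (m - (j + 1))) (conv (edgeAC (wR w s(a, c (j + 1)))) (edgeBC (wR w s(b, c (j + 1))))))
        (conv (edgeBC (wR w s(b, c j))) (blockIn q w a b c j)) (β : ℝ) (α : ℝ) := by
  set w₁ := Function.update w s(c j, c (j + 1)) β with hw₁
  set w₂ := Function.update w₁ s(a, c j) α with hw₂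
  have hj0 : j ≤ m := by omega
  have hlater1 : ∀ k, j + 1 < k → k ≤ m → ¬ ReadsAt a b c k s(c j, c (j + 1)) := fun k hk hkm hr =>
    absurd ((readsAt_rim_iff hinj hca hcb hj hkm).1 hr) (by omega)
  have hlater2 : ∀ k, j < k → k ≤ m → ¬ ReadsAt a b c k s(a, c j) := fun k hk hkm hr =>
    absurd ((readsAt_spokeA_iff hab hinj hca hcb hj0 hkm).1 hr) (by omega)
  have hrest : restVec q w₂ a b c (j + 1) (m - (j + 1)) = restVec q w a b c (j + 1) (m - (j + 1)) := by
    rw [hw₂, restVec_update_eq q w₁ α (m - (j + 1)) (j + 1) (by omega) (fun k hk hkm => hlater2 k (by omega) hkm), hw₁,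
      restVec_update_eq q w β (m - (j + 1)) (j + 1) (by omega) hlater1]
  have hin : blockIn q w₂ a b c j = blockIn q w a b c j := by
    rw [hw₂, blockIn_update_eq q w₁ α (fun k hk hr => absurd ((readsAt_spokeA_iff hab hinj hca hcb hj0 (by omega)).1 hr) (by omega))
      (spokeA_ne_axis hab hcb hj0) (fun i hi => hi ▸ spokeA_ne_rim hca (j := i + 1) (hi ▸ hj0)),
      hw₁, blockIn_update_eq q w β (fun k hk hr => absurd ((readsAt_rim_iff hinj hca hcb hj (by omega)).1 hr) (by omega))
      (rim_ne_axis hca hj) (fun i hi => rim_ne_rim hinj hj (by omega) (by omega))]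
  have hα : wR w₂ s(a, c j) = (α : ℝ) := by rw [hw₂, wR_update_self]
  have hβ : wR w₂ s(c j, c (j + 1)) = (β : ℝ) := by
    rw [hw₂, wR_update_of_ne w₁ (spokeA_ne_rim hca (j := j) hj).symm, hw₁, wR_update_self]
  have hy : wR w₂ s(b, c j) = wR w s(b, c j) := by
    rw [hw₂, wR_update_of_ne w₁ (spokeA_ne_spokeB hab hca hj0).symm, hw₁, wR_update_of_ne w (spokeB_ne_rim hcb (j := j) hj)]
  have hx1 : wR w₂ s(a, c (j + 1)) = wR w s(a, c (j + 1)) := by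
    rw [hw₂, wR_update_of_ne w₁ (spokeA_ne_spokeA hinj hj hj0 (by omega)), hw₁, wR_update_of_ne w (spokeA_ne_rim hca (j := j + 1) hj)]
  have hy1 : wR w₂ s(b, c (j + 1)) = wR w s(b, c (j + 1)) := by
    rw [hw₂, wR_update_of_ne w₁ (spokeA_ne_spokeB hab hca hj).symm, hw₁, wR_update_of_ne w (spokeB_ne_rim hcb (j := j + 1) hj)]
  have hd : m - j = (m - (j + 1)) + 1 := by omega
  rw [transferDF_eq_cut q w₂ a b c hj0, hd, restVec_succ, hrest, hβ, hx1, hy1, zDF_eq_block, hin, hα, hy]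
  -- E s' ∗ (AC α ∗ (BC y ∗ W))  ↦  (BC y ∗ W) ∗ (AC α ∗ E s')  (plain commutativity; no self-adjointness needed)
  simp only [rimSpokeAZ, ← mul_def]
  rw [mul_comm (rimStep q (β : ℝ) _) _, mul_assoc, mul_left_comm (edgeAC (α : ℝ))]

/-- **A RIM EDGE AND THE `a`-SPOKE AT ITS NEAR ENDPOINT ARE NEGATIVELY CORRELATED** (`j + 1 ≤ m`):
`φ(J_{c_j c_{j+1}} ∩ J_{a c_j}) ≤ φ(J_{c_j c_{j+1}}) φ(J_{a c_j})`. [cite: Grimmett2006, §3.9 eq. (3.94) (pp. 63–64)] -/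
theorem negCorr_rim_spokeA_self (hcard : Fintype.card V = m + 3) {q : ℝ} (hq0 : 0 < q) (hq1 : q ≤ 1) (w : Sym2 V → unitInterval)
    (hsupp : ∀ e, e ∉ dfPairs a b c m → w e = 0) {j : ℕ} (hj : j + 1 ≤ m) :
    (rcMeasureW w q ∅).real ({ω : BondConfig V | s(c j, c (j + 1)) ∈ ω} ∩ {ω | s(a, c j) ∈ ω}) ≤
      (rcMeasureW w q ∅).real {ω : BondConfig V | s(c j, c (j + 1)) ∈ ω} *
        (rcMeasureW w q ∅).real {ω : BondConfig V | s(a, c j) ∈ ω} := by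
  have hj0 : j ≤ m := by omega
  have he : s(c j, c (j + 1)) ∈ dfPairs a b c m := (mem_dfPairs_iff a b c m _).2 (Or.inr (Or.inr ⟨j, hj, rfl⟩))
  have hf : s(a, c j) ∈ dfPairs a b c m := (mem_dfPairs_iff a b c m _).2 (Or.inr (Or.inl ⟨j, hj0, Or.inl rfl⟩))
  have hne : s(a, c j) ≠ s(c j, c (j + 1)) := spokeA_ne_rim hca (j := j) hj
  set u := conv (restVec q w a b c (j + 1) (m - (j + 1))) (conv (edgeAC (wR w s(a, c (j + 1)))) (edgeBC (wR w s(b, c (j + 1))))) with hu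
  set s := conv (edgeBC (wR w s(b, c j))) (blockIn q w a b c j) with hs
  have hZ : ∀ β α : unitInterval, rcPartitionFunctionW (Function.update (Function.update w s(c j, c (j + 1)) β) s(a, c j) α) q ∅ =
      rimSpokeAZ q u s (β : ℝ) (α : ℝ) := by
    intro β α
    rw [rcPartitionFunctionW_eq_transferDF hab hinj hca hcb hcard q _
      (supp_update_dfPair _ (supp_update_dfPair w hsupp he β) hf α),
      cut_pin_rim_spokeA_self hab hinj hca hcb q w hj β α]
  have huK : InKE q u := InKE.mul (inKE_restVec q w a b c (m - (j + 1)) (j + 1))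
    (InKE.step (IsLetter.ac (w _).2.1 (w _).2.2) (by
      rw [← mul_one (edgeBC (wR w s(b, c (j + 1)))), mul_def, one_def]
      exact InKE.step (IsLetter.bc (w _).2.1 (w _).2.2) InKE.base))
  have hsK : InKE q s := InKE.step (IsLetter.bc (w _).2.1 (w _).2.2) (inKE_blockIn q w a b c j)
  have key := InKE.rayleigh_rim_spokeA_nonneg hq0.le hq1 huK hsK
  refine negCorr_of_pinned_rayleigh w hq0 hne ?_
  rw [hZ 1 1, hZ 0 0, hZ 1 0, hZ 0 1]
  simp only [Set.Icc.coe_one, Set.Icc.coe_zero]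
  linarith [key]

/-! ### The `b`-versions: swap the roles of the two apices -/

/-- **A rim edge and the `b`-spoke at its far endpoint are negatively correlated.** [cite: Grimmett2006, §3.9 eq. (3.94) (pp. 63–64)] -/
theorem negCorr_rim_spokeB_succ (hcard : Fintype.card V = m + 3) {q : ℝ} (hq0 : 0 < q) (hq1 : q ≤ 1) (w : Sym2 V → unitInterval)
    (hsupp : ∀ e, e ∉ dfPairs a b c m → w e = 0) {j : ℕ} (hj : j + 1 ≤ m) :
    (rcMeasureW w q ∅).real ({ω : BondConfig V | s(c j, c (j + 1)) ∈ ω} ∩ {ω | s(b, c (j + 1)) ∈ ω}) ≤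
      (rcMeasureW w q ∅).real {ω : BondConfig V | s(c j, c (j + 1)) ∈ ω} *
        (rcMeasureW w q ∅).real {ω : BondConfig V | s(b, c (j + 1)) ∈ ω} :=
  negCorr_rim_spokeA_succ hab.symm hinj hcb hca hcard hq0 hq1 w (fun e he => hsupp e (by rwa [dfPairs_swap] at he)) hj

/-- **A rim edge and the `b`-spoke at its near endpoint are negatively correlated.** [cite: Grimmett2006, §3.9 eq. (3.94) (pp. 63–64)] -/
theorem negCorr_rim_spokeB_self (hcard : Fintype.card V = m + 3) {q : ℝ} (hq0 : 0 < q) (hq1 : q ≤ 1) (w : Sym2 V → unitInterval)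
    (hsupp : ∀ e, e ∉ dfPairs a b c m → w e = 0) {j : ℕ} (hj : j + 1 ≤ m) :
    (rcMeasureW w q ∅).real ({ω : BondConfig V | s(c j, c (j + 1)) ∈ ω} ∩ {ω | s(b, c j) ∈ ω}) ≤
      (rcMeasureW w q ∅).real {ω : BondConfig V | s(c j, c (j + 1)) ∈ ω} *
        (rcMeasureW w q ∅).real {ω : BondConfig V | s(b, c j) ∈ ω} :=
  negCorr_rim_spokeA_self hab.symm hinj hcb hca hcard hq0 hq1 w (fun e he => hsupp e (by rwa [dfPairs_swap] at he)) hj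

end Setting

end ThreeApex

end FK

end Summit.CriticalPhenomena.PercolationContinuityZ3.Theorems
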